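import Mathlib
import Literature.Analysis.FluidPDE.Tao2016AveragedNS.ViscousLatticeFlows
import Literature.Analysis.FluidPDE.Tao2016AveragedNS.ViscousSmoothingBootstrap
import HarnessLib

/-!
# Tao 2016, §4 / Barbato–Morandin–Romito 2011, §3.2: a subcritical tail-energy envelope smooths the
# NS-scaled viscous cascade lattice (global regularity from the dissipation bootstrap)

T. Tao, *Finite time blowup for an averaged three-dimensional Navier–Stokes equation*, J. Amer. Math.
Soc. **29** (2016), §4 (the viscous equation before Thm. 4.2; Lemma 4.1 (4.5), (4.7), (4.11)).
D. Barbato, F. Morandin, M. Romito, *Smooth solutions for the dyadic model*, Nonlinearity **24** (2011)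
3083–3097, §3.2 (proof of Thm. 1: the smoothing bootstrap).

For a table of structure constants bounded by `M_α` (in particular every table of the class `E₂(R)`),
scale ratio `1+ε₀ ≥ 1`, viscosity `ν > 0` and a one-shell datum at shell `0`, we prove: if on every
window `[0,T]` the tail energies of all regular solutions of the `ν`-viscous lattice on sub-windows
`[0,s] ⊆ [0,T]` are bounded by a SUBCRITICAL geometric envelope `C(T)(1+ε₀)^{-(1+η)n}` (`η > 0`),
then a GLOBAL REGULAR viscous solution exists (`ViscousGlobal`).  Mechanism: the envelope bounds the
amplitudes by `√(2C)(1+ε₀)^{-(1+η)n/2}`; finitely many stages of `viscous_bootstrap_step`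
(`γ ↦ 2γ − 1/2`, starting above the critical `1/2`) reach the (4.5) weight `(1+ε₀)^{10n}` uniformly on
sub-windows; the continuation criterion `exists_viscousGlobal_of_apriori_bound` concludes.  This is
the «envelope ⇒ viscous stall» step of dissipation-bootstrap arguments, for the VISCOUS family and
with sub-window-uniform constants (the form a continuation argument consumes).

MODEL lattice ODEs only; nothing here is a statement about the Navier–Stokes equations.
-/

noncomputable section

open Set Metric Filter Topology BoundedContinuousFunction Finset

namespace Literature.Analysis.FluidPDE

namespace TaoCascade

variable {m : ℕ}

/-! ### The a priori weight `(1+ε₀)^{10 k⁺}` is admissible -/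

/-- The weight `w_k = (1+ε₀)^{10 max(k,0)}` (the (4.5) weight ahead of the datum shell, constant behind
it) has bounded gain/weight ratios: `WeightRatiosLE ε₀ w ((1+ε₀)^{10})`.
[cite: Tao2016AveragedNS, §4 Lemma 4.1 (4.5) (the weight `(1+ε₀)^{10n}`)] -/
theorem weightRatiosLE_aprioriWeight {ε₀ : ℝ} (hε₀ : 0 ≤ ε₀) :
    WeightRatiosLE ε₀ (fun k : ℤ => (1 + ε₀) ^ ((10 : ℝ) * ((max k 0 : ℤ) : ℝ)))
      ((1 + ε₀) ^ (10 : ℝ)) := by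
  have hl1 : (1 : ℝ) ≤ 1 + ε₀ := by linarith
  have hl0 : (0 : ℝ) < 1 + ε₀ := by linarith
  have hA1 : (1 : ℝ) ≤ (1 + ε₀) ^ (10 : ℝ) := Real.one_le_rpow hl1 (by norm_num)
  have hwpos : ∀ k : ℤ, 0 < (1 + ε₀) ^ ((10 : ℝ) * ((max k 0 : ℤ) : ℝ)) := fun k =>
    Real.rpow_pos_of_pos hl0 _
  -- `λ^a / λ^b = λ^(a-b) ≤ λ^10` whenever `a - b ≤ 10`
  have key : ∀ a b : ℝ, a - b ≤ 10 → (1 + ε₀) ^ a / (1 + ε₀) ^ b ≤ (1 + ε₀) ^ (10 : ℝ) := by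
    intro a b hab
    rw [← Real.rpow_sub hl0]
    exact Real.rpow_le_rpow_of_exponent_le hl1 hab
  refine ⟨hwpos, fun k => ⟨?_, ?_, ?_⟩⟩
  · refine key _ _ ?_
    rcases le_or_gt 0 k with hk | hk
    · rw [max_eq_left hk]
      have h0 : (0 : ℝ) ≤ k := by exact_mod_cast hk
      linarith
    · rw [max_eq_right hk.le]
      have h0 : (k : ℝ) ≤ 0 := by exact_mod_cast hk.le
      push_cast
      linarith
  · refine key _ _ ?_
    rcases le_or_gt 0 (k + 1) with hk | hk
    · rw [max_eq_left hk]
      have h0 : (-1 : ℝ) ≤ k := by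
        have : (-1 : ℤ) ≤ k := by omega
        exact_mod_cast this
      push_cast
      linarith
    · rw [max_eq_right hk.le]
      have h0 : (k : ℝ) ≤ 0 := by
        have : k ≤ 0 := by omega
        exact_mod_cast this
      push_cast
      linarith
  · show (1 + ε₀) ^ ((5 : ℝ) * ((k : ℝ) - 1) / 2) * (1 + ε₀) ^ ((10 : ℝ) * ((max k 0 : ℤ) : ℝ)) /
        ((1 + ε₀) ^ ((10 : ℝ) * ((max (k - 1) 0 : ℤ) : ℝ))) ^ 2 ≤ (1 + ε₀) ^ (10 : ℝ)
    have hsq : ((1 + ε₀) ^ ((10 : ℝ) * ((max (k - 1) 0 : ℤ) : ℝ))) ^ 2 =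
        (1 + ε₀) ^ ((20 : ℝ) * ((max (k - 1) 0 : ℤ) : ℝ)) := by
      rw [sq, ← Real.rpow_add hl0]; ring_nf
    rw [hsq, ← Real.rpow_add hl0]
    refine key _ _ ?_
    rcases le_or_gt 1 k with hk | hk
    · rw [max_eq_left (by omega : (0 : ℤ) ≤ k), max_eq_left (by omega : (0 : ℤ) ≤ k - 1)]
      have h0 : (1 : ℝ) ≤ k := by exact_mod_cast hk
      push_cast
      linarith
    · rw [max_eq_right (by omega : k - 1 ≤ 0)]
      rcases le_or_gt 0 k with hk' | hk'
      · rw [max_eq_left hk']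
        have h0 : (k : ℝ) ≤ 0 := by exact_mod_cast (show k ≤ 0 by omega)
        have h1 : (0 : ℝ) ≤ k := by exact_mod_cast hk'
        push_cast
        linarith
      · rw [max_eq_right hk'.le]
        have h0 : (k : ℝ) ≤ 0 := by exact_mod_cast hk'.le
        push_cast
        linarith

/-- The weight `(1+ε₀)^{10 k⁺}` dominates the (4.5) weight: `(1 + (1+ε₀)^{10k}) / w_k ≤ 2`.
[cite: Tao2016AveragedNS, §4 Lemma 4.1 (4.5)] -/
theorem aprioriWeight_dominates {ε₀ : ℝ} (hε₀ : 0 ≤ ε₀) (k : ℤ) :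
    (1 + (1 + ε₀) ^ ((10 : ℝ) * k)) / (1 + ε₀) ^ ((10 : ℝ) * ((max k 0 : ℤ) : ℝ)) ≤ 2 := by
  have hl1 : (1 : ℝ) ≤ 1 + ε₀ := by linarith
  have hl0 : (0 : ℝ) < 1 + ε₀ := by linarith
  have hw : 0 < (1 + ε₀) ^ ((10 : ℝ) * ((max k 0 : ℤ) : ℝ)) := Real.rpow_pos_of_pos hl0 _
  rw [div_le_iff₀ hw]
  have h0 : (0 : ℝ) ≤ ((max k 0 : ℤ) : ℝ) := by exact_mod_cast le_max_right k 0
  have h1 : (1 : ℝ) ≤ (1 + ε₀) ^ ((10 : ℝ) * ((max k 0 : ℤ) : ℝ)) :=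
    Real.one_le_rpow hl1 (by linarith)
  have h2 : (1 + ε₀) ^ ((10 : ℝ) * k) ≤ (1 + ε₀) ^ ((10 : ℝ) * ((max k 0 : ℤ) : ℝ)) :=
    Real.rpow_le_rpow_of_exponent_le hl1 (by
      have : (k : ℝ) ≤ ((max k 0 : ℤ) : ℝ) := by exact_mod_cast le_max_left k 0
      nlinarith)
  linarith

/-! ### Envelope smoothing: a subcritical tail-energy envelope gives a global regular viscous solution -/

/-- **ENVELOPE SMOOTHING for the NS-scaled viscous cascade lattice** (BMR §3.2 bootstrap, sign-free,
general table).  Let the structure constants be bounded by `M_α`, `ε₀ ≥ 0`, `ν > 0`, `η > 0`, and let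
`X₀` be a one-shell datum at shell `0`.  Suppose that on every horizon `T > 0` there is `C` such that
every regular solution of the `ν`-viscous lattice from `X₀` on any sub-window `[0,s] ⊆ [0,T]` has the
SUBCRITICAL TAIL-ENERGY ENVELOPE `Σ_{k=n}^{N} Σ_i ½X_{i,k}(t)² ≤ C(1+ε₀)^{-(1+η)n}` (`0 ≤ n ≤ N`,
`t ∈ [0,s]`).  Then the `ν`-viscous lattice has a GLOBAL REGULAR solution from `X₀`
(`ViscousGlobal ε₀ ν α X₀ X`): the envelope gives amplitudes `≤ √(2C)(1+ε₀)^{-(1+η)n/2}`, finitely many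
dissipation stages `γ ↦ 2γ − 1/2` (`viscous_bootstrap_step`) reach the (4.5) weight uniformly on
sub-windows, and the continuation criterion `exists_viscousGlobal_of_apriori_bound` concludes.
[cite: BarbatoMorandinRomito2011, §3.2 (proof of Thm. 1) with §3.1 Prop. 3.3; Tao2016AveragedNS, §4 (viscous equation before Thm. 4.2, Lemma 4.1 (4.5), (4.7), (4.11))] -/
theorem exists_viscousGlobal_of_subcriticalEnvelope {ε₀ η ν Mα : ℝ} (hε₀ : 0 ≤ ε₀) (hη : 0 < η)
    (hν : 0 < ν) (hMα : 0 ≤ Mα) {α : Fin m → Fin m → Fin m → ℤ × ℤ × ℤ → ℝ}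
    (hα : ∀ i₁ i₂ i₃ μ, |α i₁ i₂ i₃ μ| ≤ Mα) (X₀ : Fin m → ℝ)
    (henv : ∀ T : ℝ, 0 < T → ∃ C : ℝ, ∀ s ∈ Ioc 0 T, ∀ X : Fin m → ℤ → ℝ → ℝ,
      (∀ i k, X i k 0 = if k = 0 then X₀ i else 0) →
      (∀ i k, k < 0 → ∀ t, X i k t = 0) →
      (∃ M : ℝ, ∀ (t : ℝ) (i : Fin m) (k : ℤ), (1 + (1 + ε₀) ^ ((10 : ℝ) * k)) * |X i k t| ≤ M) →
      (∀ i k, Continuous (X i k)) →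
      (∀ i k, ∀ t ∈ Icc 0 s, HasDerivWithinAt (X i k)
        (quadTerm ε₀ α X i k t - ν * (1 + ε₀) ^ ((2 : ℝ) * k) * X i k t) (Icc 0 s) t) →
      ∀ n N : ℕ, n ≤ N → ∀ t ∈ Icc 0 s,
        ∑ k ∈ Finset.Icc n N, ∑ i, (1 / 2) * X i (k : ℤ) t ^ 2 ≤
          C * (1 + ε₀) ^ (-((1 + η) * (n : ℝ)))) :
    ∃ X : Fin m → ℤ → ℝ → ℝ, ViscousGlobal ε₀ ν α X₀ X := by
  have hl1 : (1 : ℝ) ≤ 1 + ε₀ := by linarith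
  have hl0 : (0 : ℝ) < 1 + ε₀ := by linarith
  set w : ℤ → ℝ := fun k => (1 + ε₀) ^ ((10 : ℝ) * ((max k 0 : ℤ) : ℝ)) with hw
  have hwpos : ∀ k, 0 < w k := fun k => Real.rpow_pos_of_pos hl0 _
  refine exists_viscousGlobal_of_apriori_bound hl0.le (weightRatiosLE_aprioriWeight hε₀) hMα hα
    (D := 2) (fun k => aprioriWeight_dominates hε₀ k) hν.le X₀ fun T hT => ?_
  obtain ⟨C, hC⟩ := henv T hT
  -- the constants of the bootstrap
  set C' : ℝ := max C 0 with hC'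
  set B₀ : ℝ := ∑ i, |X₀ i| with hB₀
  have hB₀0 : 0 ≤ B₀ := Finset.sum_nonneg fun i _ => abs_nonneg _
  set γ : ℕ → ℝ := fun k => 1 / 2 + 2 ^ k * (η / 2) with hγ
  have hγ0 : ∀ k, 0 ≤ γ k := fun k => by rw [hγ]; positivity
  have hγsucc : ∀ k, 2 * γ k - 1 / 2 = γ (k + 1) := fun k => by
    simp only [hγ, pow_succ]; ring
  let Dseq : ℕ → ℝ := fun k => Nat.rec (Real.sqrt (2 * C'))
    (fun k Dk => B₀ + 4 * (m : ℝ) ^ 2 * Mα * (1 + ε₀) ^ (2 * γ k) * Dk ^ 2 / ν) k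
  have hDseq0 : Dseq 0 = Real.sqrt (2 * C') := rfl
  have hDseqS : ∀ k, Dseq (k + 1) = B₀ + 4 * (m : ℝ) ^ 2 * Mα * (1 + ε₀) ^ (2 * γ k) * Dseq k ^ 2 / ν :=
    fun k => rfl
  have hDpos : ∀ k, 0 ≤ Dseq k := fun k => by
    induction k with
    | zero => rw [hDseq0]; exact Real.sqrt_nonneg _
    | succ k _ => rw [hDseqS]; positivity
  -- the number of stages
  obtain ⟨K, hK⟩ : ∃ K : ℕ, (10 : ℝ) ≤ γ K := by
    obtain ⟨K, hK⟩ := pow_unbounded_of_one_lt (19 / η) (by norm_num : (1 : ℝ) < 2)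
    refine ⟨K, ?_⟩
    rw [hγ]; simp only
    rw [div_lt_iff₀ hη] at hK
    linarith
  refine ⟨Dseq K, fun s hs X hinit hlow hbdd hcont hder t ht i k => ?_⟩
  -- the envelope gives the base decay
  have hbase : ∀ j (n : ℤ), 0 ≤ n → ∀ τ ∈ Icc 0 s, |X j n τ| ≤ Dseq 0 * (1 + ε₀) ^ (-(γ 0 * n)) := by
    intro j n hn τ hτ
    obtain ⟨n', rfl⟩ := Int.eq_ofNat_of_zero_le hn
    obtain ⟨M, hM⟩ := hbdd
    have hM' : ∀ (t : ℝ) (i : Fin m) (k : ℤ), (1 + (1 + ε₀) ^ ((10 : ℝ) * k)) * |X i k t| ≤ 2 * M := by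
      intro t' i' k'
      have hd := aprioriWeight_dominates hε₀ k'
      rw [div_le_iff₀ (hwpos k')] at hd
      calc (1 + (1 + ε₀) ^ ((10 : ℝ) * k')) * |X i' k' t'| ≤ 2 * w k' * |X i' k' t'| :=
            mul_le_mul_of_nonneg_right hd (abs_nonneg _)
        _ = 2 * (w k' * |X i' k' t'|) := by ring
        _ ≤ 2 * M := by linarith [hM t' i' k']
    have h1 := hC s hs X hinit hlow ⟨2 * M, hM'⟩ hcont hder n' n' le_rfl τ hτ
    rw [Finset.Icc_self, Finset.sum_singleton] at h1
    have h2 : (1 / 2) * X j (n' : ℤ) τ ^ 2 ≤ C' * (1 + ε₀) ^ (-((1 + η) * (n' : ℝ))) :=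
      ((Finset.single_le_sum (fun i _ => by positivity) (Finset.mem_univ j)).trans h1).trans
        (mul_le_mul_of_nonneg_right (le_max_left _ _) (Real.rpow_nonneg hl0.le _))
    have hp : ((1 + ε₀) ^ (-(γ 0 * ((n' : ℤ) : ℝ)))) ^ 2 = (1 + ε₀) ^ (-((1 + η) * (n' : ℝ))) := by
      rw [sq, ← Real.rpow_add hl0]
      congr 1
      rw [hγ]; push_cast; ring
    have h3 : X j (n' : ℤ) τ ^ 2 ≤ (Dseq 0 * (1 + ε₀) ^ (-(γ 0 * (n' : ℤ)))) ^ 2 := by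
      rw [mul_pow, hDseq0, Real.sq_sqrt (by positivity), hp]
      linarith
    have h4 : 0 ≤ Dseq 0 * (1 + ε₀) ^ (-(γ 0 * (n' : ℤ))) :=
      mul_nonneg (hDpos 0) (Real.rpow_nonneg hl0.le _)
    exact abs_le_of_sq_le_sq' h3 h4 |>.elim (fun h5 h6 => abs_le.2 ⟨h5, h6⟩)
  -- the bootstrap
  have hstage : ∀ kk : ℕ, ∀ j (n : ℤ), 0 ≤ n → ∀ τ ∈ Icc 0 s,
      |X j n τ| ≤ Dseq kk * (1 + ε₀) ^ (-(γ kk * n)) := by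
    intro kk
    induction kk with
    | zero => exact hbase
    | succ kk ih =>
      intro j n hn τ hτ
      have h := viscous_bootstrap_step hε₀ hν hMα (hDpos kk) (hγ0 kk) hB₀0 hα
        (X := X) (s := s)
        (fun i => by
          rw [hinit, if_pos rfl]
          exact Finset.single_le_sum (fun i _ => abs_nonneg (X₀ i)) (Finset.mem_univ i))
        (fun i k hk => by rw [hinit, if_neg hk]) (fun i k hk τ _ => hlow i k hk τ) hder ih j n hn τ hτ
      rw [hγsucc, ← hDseqS] at h
      exact h
  -- conclusion: the weighted bound
  rcases lt_or_ge k 0 with hk | hk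
  · rw [hlow i k hk t, abs_zero, mul_zero]; exact hDpos K
  · have h := hstage K i k hk t ht
    rw [show ((max k 0 : ℤ) : ℝ) = (k : ℝ) by rw [max_eq_left hk]]
    have hkr : (0 : ℝ) ≤ k := by exact_mod_cast hk
    have hexp : (1 + ε₀) ^ ((10 : ℝ) * k) * (1 + ε₀) ^ (-(γ K * k)) ≤ 1 := by
      rw [← Real.rpow_add hl0]
      exact Real.rpow_le_one_of_one_le_of_nonpos hl1 (by nlinarith)
    calc (1 + ε₀) ^ ((10 : ℝ) * k) * |X i k t|
        ≤ (1 + ε₀) ^ ((10 : ℝ) * k) * (Dseq K * (1 + ε₀) ^ (-(γ K * k))) :=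
          mul_le_mul_of_nonneg_left h (Real.rpow_nonneg hl0.le _)
      _ = Dseq K * ((1 + ε₀) ^ ((10 : ℝ) * k) * (1 + ε₀) ^ (-(γ K * k))) := by ring
      _ ≤ Dseq K * 1 := mul_le_mul_of_nonneg_left hexp (hDpos K)
      _ = Dseq K := mul_one _


/-- A global regular viscous solution for the table restricted to the shift set is one for the table
(the motion only reads the structure constants on `S`). [cite: Tao2016AveragedNS, §4 after (4.1) (only shifts in `S` occur)] -/
theorem ViscousGlobal.of_restrictShiftSet {ε₀ ν : ℝ} {α : Fin m → Fin m → Fin m → ℤ × ℤ × ℤ → ℝ}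
    {X₀ : Fin m → ℝ} {X : Fin m → ℤ → ℝ → ℝ} (h : ViscousGlobal ε₀ ν (restrictShiftSet α) X₀ X) :
    ViscousGlobal ε₀ ν α X₀ X where
  contDiffOn := h.contDiffOn
  apriori := h.apriori
  init := h.init
  motion i n t ht := by rw [← quadTerm_restrictShiftSet]; exact h.motion i n t ht
  noLow := h.noLow

/-- **ENVELOPE SMOOTHING for the tables of the class `E₂(R)`** (`InTableClass R α`: structure
constants of modulus `≤ 1` on the shift set): the statement of
`exists_viscousGlobal_of_subcriticalEnvelope` for such a table — a subcritical tail-energy envelope,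
uniform over the regular `ν`-viscous solutions on the sub-windows of every `[0,T]`, gives a global
regular viscous solution `ViscousGlobal ε₀ ν α X₀ X`.
[cite: BarbatoMorandinRomito2011, §3.2; Tao2016AveragedNS, §4 (viscous equation before Thm. 4.2), §6.1 (the class of tables)] -/
theorem exists_viscousGlobal_of_subcriticalEnvelope_of_inTableClass {ε₀ η ν R : ℝ} (hε₀ : 0 ≤ ε₀)
    (hη : 0 < η) (hν : 0 < ν) {α : Fin m → Fin m → Fin m → ℤ × ℤ × ℤ → ℝ} (hα : InTableClass R α)
    (X₀ : Fin m → ℝ)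
    (henv : ∀ T : ℝ, 0 < T → ∃ C : ℝ, ∀ s ∈ Ioc 0 T, ∀ X : Fin m → ℤ → ℝ → ℝ,
      (∀ i k, X i k 0 = if k = 0 then X₀ i else 0) →
      (∀ i k, k < 0 → ∀ t, X i k t = 0) →
      (∃ M : ℝ, ∀ (t : ℝ) (i : Fin m) (k : ℤ), (1 + (1 + ε₀) ^ ((10 : ℝ) * k)) * |X i k t| ≤ M) →
      (∀ i k, Continuous (X i k)) →
      (∀ i k, ∀ t ∈ Icc 0 s, HasDerivWithinAt (X i k)
        (quadTerm ε₀ α X i k t - ν * (1 + ε₀) ^ ((2 : ℝ) * k) * X i k t) (Icc 0 s) t) →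
      ∀ n N : ℕ, n ≤ N → ∀ t ∈ Icc 0 s,
        ∑ k ∈ Finset.Icc n N, ∑ i, (1 / 2) * X i (k : ℤ) t ^ 2 ≤
          C * (1 + ε₀) ^ (-((1 + η) * (n : ℝ)))) :
    ∃ X : Fin m → ℤ → ℝ → ℝ, ViscousGlobal ε₀ ν α X₀ X := by
  obtain ⟨X, hX⟩ := exists_viscousGlobal_of_subcriticalEnvelope hε₀ hη hν zero_le_one
    (abs_restrictShiftSet_le zero_le_one (abs_le_one_of_inTableClass hα)) X₀ (fun T hT => by
      obtain ⟨C, hC⟩ := henv T hT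
      refine ⟨C, fun s hs X hinit hlow hbdd hcont hder => hC s hs X hinit hlow hbdd hcont ?_⟩
      intro i k t ht
      have := hder i k t ht
      rwa [quadTerm_restrictShiftSet] at this)
  exact ⟨X, hX.of_restrictShiftSet⟩

end TaoCascade

end Literature.Analysis.FluidPDE

end
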